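import Summits.Ventures.PackingBounds.ThreePointCert.T25Agg1

/-!
# Tammes θ(25) ≤ arccos(727/1000) (A(3, 727/1000) ≤ 24): kernel validation of Gram block R2 (chunks 1–1 of 1)

Framing: lottery ticket; floor = certified bounds/negative ranges. Venture `PackingBounds` (cell
`pub-packcert`), three-point SDP family. Integer data of a feasible point of the Bachoc–Vallentin
semidefinite program (n = 3, s = 727/1000, degree d = 10, Bachoc–Vallentin
multiplier set = cell mode sym2), derived by `cert2lean_s2.py` (sdp gen 5 fork of cert2lean_lp.py) from the exact rational certificate
`sdp-n3-d10-s727-1000-sym2f-lpclient-v1.json` of the cell (exact verifier #1 + verifier #2 of the other seat), in the units of the kernel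
checker `ThreePointCert.Check` + `CheckSym2` (soundness `card_le_of_cert3S2`); Gram factors offset-encoded for the
Kronecker-packed chunk validation `ThreePointCert.CheckKron` (emitter `emitleanS2.py` = lp gen 3 emitleanK.py). Generated file: plain
lists of integers / monomials.
-/

namespace Summit.Ventures.PackingBounds.ThreePointCert.T25

open Literature.Geometry.DiscreteGeometry Literature.Geometry.DiscreteGeometry.PolyCert PolyCert.SPoly

set_option maxRecDepth 100000 in
set_option maxHeartbeats 0 in
/-- Block `R2`: rows from 0 (T25.gR2K.z.length rows) of `zᵀ(LLᵀ)z` added to `[]` give `eR2` (kernel, Kronecker-packed chunk check). -/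
theorem okR2_1 : chunkOKK T25.gR2K 0 T25.gR2K.z.length [] T25.eR2 = true := by
  decide +kernel

end Summit.Ventures.PackingBounds.ThreePointCert.T25
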